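import Literature.InformationTheory.Entanglement.TwoCopySwapPurity
import Mathlib.LinearAlgebra.UnitaryGroup
import HarnessLib

/-!
# Dual-unitary gates (Bertini–Kos–Prosen 2019)

Vocabulary file (0 facts, 0 sorry) for the notion behind the "exactly verifiable" many-body
benchmark of Fischer et al. (register E-36): a two-site gate `U` on `ℂ^m ⊗ ℂ^m` is
**dual-unitary** when both `U` and its *dual* `Ũ` — the gate read "sideways", with the roles of
space and time exchanged — are unitary [BertiniKosProsen2019, eqs. (6)–(7)]; for such gates the
infinite-temperature dynamical correlations of single-site observables in the brickwork circuit
vanish except on the light-cone edges `x = ± t` (Property 1, eq. (12)), where they are given by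
powers of the single-site channels `M_±` (eqs. (17)–(19)). Fischer et al. use exactly this: "for
`J = b = π/4` the gates are dual unitary for any choice of `h`", so the kicked-Ising autocorrelator
`C_n(t)` is known in closed form and is `0` off the light cone (their eq. (2) and Methods ‘Dual
unitarity’: "If the dual is unitary, i.e. if `U_D† U_D = U_D U_D† = 𝟙`, then the gate `U` is
called dual-unitary").

## What is formalised (finite local dimension `m`, matrices over `ℂ`)

* `dualGate U` — the dual gate exactly as printed: with `U_{ij}^{kl} = ⟨k|⊗⟨l| U |i⟩⊗|j⟩`
  (eq. (SM-1)) the dual is `Ũ_{ik}^{jl} = U_{ij}^{kl}` (eq. (SM-2)), equivalently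
  `⟨k|⊗⟨l| Ũ |i⟩⊗|j⟩ = ⟨j|⊗⟨l| U |i⟩⊗|k⟩` (eq. (5)); as a `Matrix` (row = output pair):
  `dualGate U (k,l) (i,j) = U (j,l) (i,k)`. It is an involution (`dualGate_dualGate`).
* `IsDualUnitary U := U ∈ unitaryGroup ∧ dualGate U ∈ unitaryGroup` (eqs. (6)–(7)), and
  `IsDualUnitary.dualGate` (the dual of a dual-unitary gate is dual-unitary).
* `reshuffle U` — the operator-space realignment `U^R ((i,k),(j,l)) = U ((i,j),(k,l))`; the printed
  dual is `F (U^R)ᵀ F` with `F` = SWAP (`dualGate_eq_swapOp_mul_transpose_reshuffle`), hence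
  `Ũ` is unitary iff `U^R` is (`dualGate_mem_unitaryGroup_iff`, `isDualUnitary_iff_reshuffle`).
* **Space unitarity as an operator identity** (the content of the "dual fusion rules", SM §1):
  `tr₂[U (a ⊗ 𝟙) U†]_{ii'} = Σ_{kk'} a_{kk'} (U^R U^R†)_{(i,k),(i',k')}` for every gate
  (`traceRight_conj_kronecker_one`), so `Ũ` unitary ⇔ `tr₂[U (a ⊗ 𝟙) U†] = (Tr a)·𝟙` for all
  single-site `a` (`isDualUnitary_iff`): the first output retains nothing of the first input.
* **One-gate light cone**: for dual-unitary `U`, `Tr[(b ⊗ 𝟙) U (a ⊗ 𝟙) U†] = Tr a · Tr b`, hence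
  `0` for traceless `a` (`trace_sameSite_of_isDualUnitary`, `…_eq_zero_…`) — the elementary step
  ("using the unitarity of `Ũ`", proof of Property 1) by which same-site correlations die.
* Examples: SWAP is self-dual and dual-unitary (`dualGate_swapOp`, `isDualUnitary_swapOp`; text
  after eq. (22)); SWAP times any unimodular diagonal two-site phase gate is dual-unitary
  (`isDualUnitary_swapOp_mul_diagonal`) and single-site dressing `(u₁ ⊗ u₂) U (v₁ ⊗ v₂)` preserves
  dual-unitarity (`IsDualUnitary.conj_local`; cf. eq. (23) and SM §3, eq. (SM-15)).
* The channels `M₊(a) = (1/d) tr₁[U† (a ⊗ 𝟙) U]`, `M₋(a) = (1/d) tr₂[U† (𝟙 ⊗ a) U]` (eqs.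
  (18)–(19)) with unitality and trace preservation for unitary `U` (text after eq. (20)); for the
  SWAP-times-phase family `M₊` is the Schur multiplier by `G_{jj'} = (1/d) Σ_i conj(d_{ij}) d_{ij'}`
  (`mPlus_swapOp_mul_diagonal`; diagonal operators fixed, `…_diagonal_diagonal`), and for qubits with
  the `V[J]` phases the off-diagonal factor is `sin 2J` (`schurFactor_qubit_eq_sin`) — the printed
  `𝓜[J] = diag(1, sin 2J, sin 2J, 1)` (text after eq. (26)).

## What is NOT formalised

The brickwork circuit on `2L` sites, Property 1 / eq. (12) and Property 2 / eq. (17) for all `t`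
(they need the many-site tensor-network calculus), complete positivity and contractivity of `M_±`
(SM §2), the completeness of the qubit parametrisation eq. (23) (SM §3), and the identification of
the kicked-Ising gates at `|J| = |b| = π/4` with this family (eq. (25), SM §4), the rotation
factors `R[u_±]`, `R[v_±]` of eq. (26) and the factorisation `V[J] = e^{−iπ/4} F · diag(e^{−i(J−π/4) s_i s_j})`
itself (only its consequences for `F · diag(d)` are proved). Nothing here bears
on the complexity-theoretic status of the E-36 experiment; honest framing: instance-level
vocabulary for one specific advantage-adjacent claim, no statement about BQP vs BPP.

## References

* [BertiniKosProsen2019] B. Bertini, P. Kos, T. Prosen, *Exact Correlation Functions for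
  Dual-Unitary Lattice Models in 1+1 Dimensions*, Phys. Rev. Lett. 123, 210601 (2019),
  arXiv:1904.02140 (equation numbers as in arXiv v3 = published version; held text
  paper:arxiv-1904.02140, pp. 3–4 main text, p. 7 SM §1, p. 9 SM §3).
* [FischerEtAl2026] L. E. Fischer et al., *Dynamical simulations of many-body quantum chaos on a
  quantum computer*, Nature Physics (2026), arXiv:2411.00765 (held text paper:arxiv-2411.00765,
  p. 3 main text, p. 6 Methods ‘Dual unitarity’).
-/

noncomputable section

open Matrix Finset
open scoped Kronecker
open Literature.Computability.QuantumComplexity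
open Literature.Computability.QuantumComplexity.DesignAnticoncentration
open Literature.InformationTheory.Entanglement.TwoCopy

namespace Literature.MathematicalPhysics.QuantumLattice

namespace DualUnitary

variable {m : Type*} [Fintype m] [DecidableEq m]

/-! ### The dual gate, as printed, and the operator-space realignment -/

/-- **The dual gate** `Ũ` of a two-site gate `U` on `ℂ^m ⊗ ℂ^m`, exactly as printed: writing
`U_{ij}^{kl} = ⟨k| ⊗ ⟨l| U |i⟩ ⊗ |j⟩` (inputs `i j`, outputs `k l`), the dual is the
Choi–Jamiołkowski-type reshuffling `Ũ_{ik}^{jl} = U_{ij}^{kl}`, i.e.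
`⟨k| ⊗ ⟨l| Ũ |i⟩ ⊗ |j⟩ = ⟨j| ⊗ ⟨l| U |i⟩ ⊗ |k⟩` — "the roles of time and space have been
swapped". As a `Matrix` (row index = output pair, column index = input pair):
`Ũ (k,l) (i,j) = U (j,l) (i,k)`.
[cite: BertiniKosProsen2019, eq. (5) and SM §1 eqs. (SM-1)–(SM-2)]
[cite: FischerEtAl2026, Methods ‘Dual unitarity’ ("a dual operator `U_D` … through a shuffling of
some input/output subsystems of `U` (exchange of the bra/ket indices `j ↔ k`)")] -/
def dualGate (U : Matrix (m × m) (m × m) ℂ) : Matrix (m × m) (m × m) ℂ :=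
  Matrix.of fun p q => U (q.2, p.2) (q.1, p.1)

omit [Fintype m] [DecidableEq m] in
/-- Entries of the dual gate: `Ũ (k,l) (i,j) = U (j,l) (i,k)`.
[cite: BertiniKosProsen2019, eq. (5) (`⟨k|⊗⟨l| Ũ |i⟩⊗|j⟩ = ⟨j|⊗⟨l| U |i⟩⊗|k⟩`)] -/
@[simp] theorem dualGate_apply (U : Matrix (m × m) (m × m) ℂ) (k l i j : m) :
    dualGate U (k, l) (i, j) = U (j, l) (i, k) := rfl

omit [Fintype m] [DecidableEq m] in
/-- Taking the dual twice gives back the gate. [cite: BertiniKosProsen2019, eq. (5)] -/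
theorem dualGate_dualGate (U : Matrix (m × m) (m × m) ℂ) : dualGate (dualGate U) = U := by
  ext ⟨k, l⟩ ⟨i, j⟩
  rfl

/-- **The realignment** `U^R` of a two-site gate: `U^R ((i,k),(j,l)) = U ((i,j),(k,l))` (row of
`U^R` = (first output, first input), column = (second output, second input)). This is the printed
dual gate up to a transpose and a conjugation by SWAP (`dualGate_eq_swapOp_mul_transpose_reshuffle`),
so it is unitary exactly when `Ũ` is (`dualGate_mem_unitaryGroup_iff`); it is the form in which the
space-direction unitarity becomes the partial-trace identity `traceRight_conj_kronecker_one`.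
[cite: BertiniKosProsen2019, eq. (5) and SM §1 eq. (SM-2) (up to the relabelling just described)] -/
def reshuffle (U : Matrix (m × m) (m × m) ℂ) : Matrix (m × m) (m × m) ℂ :=
  Matrix.of fun p q => U (p.1, q.1) (p.2, q.2)

omit [Fintype m] [DecidableEq m] in
/-- Entries of the realignment. [cite: BertiniKosProsen2019, SM §1 eq. (SM-2) (relabelled)] -/
@[simp] theorem reshuffle_apply (U : Matrix (m × m) (m × m) ℂ) (i k j l : m) :
    reshuffle U (i, k) (j, l) = U (i, j) (k, l) := rfl

omit [Fintype m] [DecidableEq m] in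
/-- Realignment is an involution. [cite: BertiniKosProsen2019, SM §1 eq. (SM-2) (relabelled)] -/
theorem reshuffle_reshuffle (U : Matrix (m × m) (m × m) ℂ) : reshuffle (reshuffle U) = U := by
  ext ⟨i, j⟩ ⟨k, l⟩
  rfl

/-- Entries of `F X F` for the SWAP gate `F`: both index pairs are flipped. [folklore] -/
private theorem swapOp_mul_mul_swapOp_apply (X : Matrix (m × m) (m × m) ℂ)
    (p q : m × m) : (swapOp m * X * swapOp m) p q = X (p.2, p.1) (q.2, q.1) := by
  rw [Matrix.mul_apply, Finset.sum_eq_single_of_mem (q.2, q.1) (Finset.mem_univ _)]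
  · rw [Matrix.mul_apply, Finset.sum_eq_single_of_mem (p.2, p.1) (Finset.mem_univ _)]
    · simp [swapOp_apply]
    · intro r _ hr
      rw [swapOp_apply, if_neg, zero_mul]
      rintro ⟨h1, h2⟩
      exact hr (Prod.ext h2.symm h1.symm)
  · intro r _ hr
    rw [swapOp_apply, if_neg, mul_zero]
    rintro ⟨h1, h2⟩
    exact hr (Prod.ext h1 h2)

/-- **Printed dual = SWAP · (realignment)ᵀ · SWAP.**
[cite: BertiniKosProsen2019, eq. (5) and SM §1 eq. (SM-2)] -/
theorem dualGate_eq_swapOp_mul_transpose_reshuffle (U : Matrix (m × m) (m × m) ℂ) :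
    dualGate U = swapOp m * (reshuffle U)ᵀ * swapOp m := by
  ext ⟨k, l⟩ ⟨i, j⟩
  rw [swapOp_mul_mul_swapOp_apply, Matrix.transpose_apply, reshuffle_apply, dualGate_apply]

/-- SWAP is unitary (`F² = 𝟙`, `F† = F`). [cite: BertiniKosProsen2019, text after eq. (22) (the
SWAP gate `U |i⟩⊗|j⟩ = |j⟩⊗|i⟩`)] -/
theorem swapOp_mem_unitaryGroup : swapOp m ∈ Matrix.unitaryGroup (m × m) ℂ := by
  rw [Matrix.mem_unitaryGroup_iff, Matrix.star_eq_conjTranspose, conjTranspose_swapOp,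
    swapOp_mul_swapOp]

/-- The printed dual `Ũ` is unitary iff the realignment `U^R` is.
[cite: BertiniKosProsen2019, eq. (7) (`ŨŨ† = Ũ†Ũ = 𝟙`)] -/
theorem dualGate_mem_unitaryGroup_iff (U : Matrix (m × m) (m × m) ℂ) :
    dualGate U ∈ Matrix.unitaryGroup (m × m) ℂ ↔ reshuffle U ∈ Matrix.unitaryGroup (m × m) ℂ := by
  rw [dualGate_eq_swapOp_mul_transpose_reshuffle]
  constructor
  · intro h
    have h2 := Submonoid.mul_mem _ (Submonoid.mul_mem _ swapOp_mem_unitaryGroup h)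
      swapOp_mem_unitaryGroup
    have h3 : swapOp m * (swapOp m * (reshuffle U)ᵀ * swapOp m) * swapOp m = (reshuffle U)ᵀ := by
      rw [show swapOp m * (swapOp m * (reshuffle U)ᵀ * swapOp m) * swapOp m =
          (swapOp m * swapOp m) * (reshuffle U)ᵀ * (swapOp m * swapOp m) by
            simp only [Matrix.mul_assoc], swapOp_mul_swapOp, Matrix.one_mul, Matrix.mul_one]
    rw [h3] at h2
    exact Matrix.transpose_mem_unitaryGroup_iff.mp h2
  · intro h
    exact Submonoid.mul_mem _ (Submonoid.mul_mem _ swapOp_mem_unitaryGroup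
      (Matrix.transpose_mem_unitaryGroup_iff.mpr h)) swapOp_mem_unitaryGroup

/-! ### Dual-unitarity -/

/-- **Dual-unitary gate**: `U` and its dual `Ũ` are both unitary ("both the evolution in time
and that in space are given in terms of unitary transfer matrices").
[cite: BertiniKosProsen2019, eqs. (6)–(7) (`UU† = U†U = 𝟙`, `ŨŨ† = Ũ†Ũ = 𝟙`; "We call
‘dual-unitary’ local gates fulfilling both (6) and (7)")]
[cite: FischerEtAl2026, Methods ‘Dual unitarity’ ("If the dual is unitary, i.e. if
`U_D† U_D = U_D U_D† = 𝟙`, then the gate `U` is called dual-unitary")] -/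
def IsDualUnitary (U : Matrix (m × m) (m × m) ℂ) : Prop :=
  U ∈ Matrix.unitaryGroup (m × m) ℂ ∧ dualGate U ∈ Matrix.unitaryGroup (m × m) ℂ

/-- Dual-unitarity via the realignment: `U` and `U^R` unitary.
[cite: BertiniKosProsen2019, eqs. (6)–(7)] -/
theorem isDualUnitary_iff_reshuffle (U : Matrix (m × m) (m × m) ℂ) :
    IsDualUnitary U ↔
      U ∈ Matrix.unitaryGroup (m × m) ℂ ∧ reshuffle U ∈ Matrix.unitaryGroup (m × m) ℂ := by
  unfold IsDualUnitary
  rw [dualGate_mem_unitaryGroup_iff]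

/-- The dual of a dual-unitary gate is dual-unitary (time ↔ space symmetry of the definition).
[cite: BertiniKosProsen2019, eqs. (6)–(7)] -/
theorem IsDualUnitary.dualGate {U : Matrix (m × m) (m × m) ℂ} (h : IsDualUnitary U) :
    IsDualUnitary (dualGate U) :=
  ⟨h.2, by rw [dualGate_dualGate]; exact h.1⟩

/-! ### The space-direction unitarity as an operator identity -/

/-- **The dual fusion rule in operator language.** For every gate `U` and every single-site operator
`a`, the first-site marginal of `U (a ⊗ 𝟙) U†` is controlled by `U^R (U^R)†` (realignment `U^R`,
unitary iff `Ũ` is): `tr₂[U (a ⊗ 𝟙) U†]_{i i'} = Σ_{k k'} a_{k k'} (U^R (U^R)†)_{(i,k),(i',k')}`.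
[cite: BertiniKosProsen2019, SM §1 (the dual fusion rules = "two different equivalent expressions
of the unitarity of Ũ")] -/
theorem traceRight_conj_kronecker_one (U : Matrix (m × m) (m × m) ℂ) (a : Matrix m m ℂ) :
    traceRight (U * (a ⊗ₖ (1 : Matrix m m ℂ)) * Uᴴ) =
      Matrix.of fun i i' => ∑ k, ∑ k', a k k' * (reshuffle U * (reshuffle U)ᴴ) (i, k) (i', k') := by
  ext i i'
  simp only [traceRight_apply, Matrix.of_apply, Matrix.mul_apply, Matrix.conjTranspose_apply,
    reshuffle_apply, Matrix.kroneckerMap_apply, Matrix.one_apply, Fintype.sum_prod_type, mul_ite,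
    mul_one, mul_zero, Finset.sum_ite_eq', Finset.mem_univ, if_true]
  simp only [Finset.sum_mul, Finset.mul_sum]
  -- LHS binders (j, k', l, k), RHS binders (k, k', j, l): reorder, then the summands agree
  calc (∑ j, ∑ k', ∑ l, ∑ k, U (i, j) (k, l) * a k k' * star (U (i', j) (k', l)))
      = ∑ j, ∑ k', ∑ k, ∑ l, U (i, j) (k, l) * a k k' * star (U (i', j) (k', l)) :=
        Finset.sum_congr rfl fun j _ => Finset.sum_congr rfl fun k' _ => Finset.sum_comm
    _ = ∑ j, ∑ k, ∑ k', ∑ l, U (i, j) (k, l) * a k k' * star (U (i', j) (k', l)) :=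
        Finset.sum_congr rfl fun j _ => Finset.sum_comm
    _ = ∑ k, ∑ j, ∑ k', ∑ l, U (i, j) (k, l) * a k k' * star (U (i', j) (k', l)) := Finset.sum_comm
    _ = ∑ k, ∑ k', ∑ j, ∑ l, U (i, j) (k, l) * a k k' * star (U (i', j) (k', l)) :=
        Finset.sum_congr rfl fun k _ => Finset.sum_comm
    _ = ∑ k, ∑ k', ∑ j, ∑ l, a k k' * (U (i, j) (k, l) * star (U (i', j) (k', l))) :=
        Finset.sum_congr rfl fun k _ => Finset.sum_congr rfl fun k' _ =>
          Finset.sum_congr rfl fun j _ => Finset.sum_congr rfl fun l _ => by ring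

/-- **Space-direction unitarity ⇒ the first-site marginal is completely depolarized.** If
`U^R (U^R)† = 𝟙` (equivalently `Ũ Ũ† = 𝟙`, `dualGate_mem_unitaryGroup_iff`) then for every
single-site operator `a`: `tr₂[U (a ⊗ 𝟙) U†] = (Tr a) · 𝟙` — whatever is fed into the first input
leaves no trace on the first output (the diagrammatic "dual fusion rule", SM §1, contracted with
`a`). [cite: BertiniKosProsen2019, eq. (7) `ŨŨ† = 𝟙` and SM §1 (dual
fusion rules, "two different equivalent expressions of the unitarity of Ũ")] -/
theorem traceRight_conj_kronecker_one_of_dual (U : Matrix (m × m) (m × m) ℂ)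
    (hU : reshuffle U * (reshuffle U)ᴴ = 1) (a : Matrix m m ℂ) :
    traceRight (U * (a ⊗ₖ (1 : Matrix m m ℂ)) * Uᴴ) = a.trace • (1 : Matrix m m ℂ) := by
  rw [traceRight_conj_kronecker_one, hU]
  ext i i'
  simp only [Matrix.of_apply, Matrix.one_apply, Prod.mk.injEq, Matrix.smul_apply, smul_eq_mul,
    mul_ite, mul_one, mul_zero]
  by_cases h : i = i'
  · subst h
    simp only [true_and, Finset.sum_ite_eq, Finset.mem_univ, if_true, Matrix.trace, Matrix.diag]
  · simp [h]

/-- **Conversely**, complete depolarization of the first-site marginal for all inputs `a` forces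
`U^R (U^R)† = 𝟙`, i.e. `Ũ` unitary (test with matrix units `a = E_{kk'}`): the operator identity IS
the space-direction unitarity. [cite: BertiniKosProsen2019, SM §1 (dual fusion rules ⇔ unitarity of Ũ)] -/
theorem dual_of_traceRight_conj_kronecker_one (U : Matrix (m × m) (m × m) ℂ)
    (h : ∀ a : Matrix m m ℂ, traceRight (U * (a ⊗ₖ (1 : Matrix m m ℂ)) * Uᴴ) = a.trace • 1) :
    reshuffle U * (reshuffle U)ᴴ = 1 := by
  ext ⟨i, k⟩ ⟨i', k'⟩
  have hkk := congr_fun (congr_fun (h (Matrix.single k k' 1)) i) i'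
  rw [traceRight_conj_kronecker_one] at hkk
  have htr : (Matrix.single k k' (1 : ℂ)).trace = if k = k' then 1 else 0 := by
    simp only [Matrix.trace, Matrix.diag, Matrix.single_apply]
    by_cases hkk' : k = k'
    · subst hkk'
      simp
    · rw [if_neg hkk']
      exact Finset.sum_eq_zero fun x _ => by
        rw [if_neg]
        rintro ⟨rfl, rfl⟩
        exact hkk' rfl
  simp only [Matrix.of_apply, Matrix.smul_apply, smul_eq_mul, Matrix.single_apply, ite_and, ite_mul,
    one_mul, zero_mul, htr] at hkk
  rw [Finset.sum_eq_single_of_mem k (Finset.mem_univ k) (fun b _ hb => by simp [Ne.symm hb])] at hkk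
  simp only [if_true] at hkk
  rw [Finset.sum_eq_single_of_mem k' (Finset.mem_univ k') (fun b _ hb => by simp [Ne.symm hb])] at hkk
  simp only [if_true] at hkk
  rw [hkk, Matrix.one_apply, Matrix.one_apply]
  by_cases h1 : i = i' <;> by_cases h2 : k = k' <;> simp [h1, h2]

/-- **Characterisation.** `U` is dual-unitary iff it is unitary and, for every single-site `a`,
`tr₂[U (a ⊗ 𝟙) U†] = (Tr a)·𝟙` (the first output of the gate retains nothing of its first input:
maximal "space-direction" scrambling). [cite: BertiniKosProsen2019, eq. (7) with SM §1 (dual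
fusion rules)] -/
theorem isDualUnitary_iff (U : Matrix (m × m) (m × m) ℂ) :
    IsDualUnitary U ↔ U ∈ Matrix.unitaryGroup (m × m) ℂ ∧
      ∀ a : Matrix m m ℂ, traceRight (U * (a ⊗ₖ (1 : Matrix m m ℂ)) * Uᴴ) = a.trace • 1 := by
  rw [isDualUnitary_iff_reshuffle]
  constructor
  · rintro ⟨hU, hD⟩
    refine ⟨hU, traceRight_conj_kronecker_one_of_dual U ?_⟩
    have := Matrix.mem_unitaryGroup_iff.mp hD
    rwa [Matrix.star_eq_conjTranspose] at this
  · rintro ⟨hU, h⟩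
    refine ⟨hU, Matrix.mem_unitaryGroup_iff.mpr ?_⟩
    rw [Matrix.star_eq_conjTranspose]
    exact dual_of_traceRight_conj_kronecker_one U h

/-! ### Examples: SWAP, and SWAP dressed with a diagonal phase gate -/

omit [Fintype m] in
/-- **The SWAP gate is self-dual**: `Ũ = U` for `U = F`. [cite: BertiniKosProsen2019, text after
eq. (22) ("An example of (i) is the SWAP gate … which is clearly self dual, i.e. U = Ũ")] -/
theorem dualGate_swapOp : dualGate (swapOp m) = swapOp m := by
  ext ⟨k, l⟩ ⟨i, j⟩
  simp only [dualGate_apply, swapOp_apply]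
  by_cases h1 : k = j
  · subst h1
    simp
  · simp [h1, Ne.symm h1]

omit [Fintype m] in
/-- The realignment of SWAP is SWAP as well. [cite: BertiniKosProsen2019, text after eq. (22)] -/
theorem reshuffle_swapOp : reshuffle (swapOp m) = swapOp m := by
  ext ⟨i, k⟩ ⟨j, l⟩
  simp only [reshuffle_apply, swapOp_apply]
  by_cases h1 : i = l <;> by_cases h2 : j = k <;> by_cases h3 : k = j <;> simp_all

/-- **SWAP is dual-unitary.** [cite: BertiniKosProsen2019, text after eq. (22)] -/
theorem isDualUnitary_swapOp : IsDualUnitary (swapOp m) :=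
  ⟨swapOp_mem_unitaryGroup, by rw [dualGate_swapOp]; exact swapOp_mem_unitaryGroup⟩

/-- The dual of `F · D` for a diagonal two-site gate `D = diag(d)`: again a phase gate times SWAP,
`(F·diag d)~ = diag(d ∘ swap) · F`. [cite: BertiniKosProsen2019, eqs. (23)–(24) (`V[J]`: at
`J₁ = J₂ = π/4` the gate `e^{−i(π/4 σˣσˣ + π/4 σʸσʸ + J σᶻσᶻ)}` is SWAP times a `σᶻσᶻ` phase, up to
a global phase)] -/
theorem reshuffle_swapOp_mul_diagonal (d : m × m → ℂ) :
    reshuffle (swapOp m * Matrix.diagonal d) =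
      Matrix.diagonal (fun p : m × m => d (p.2, p.1)) * swapOp m := by
  ext ⟨i, k⟩ ⟨j, l⟩
  rw [reshuffle_apply, Matrix.mul_diagonal, Matrix.diagonal_mul, swapOp_apply, swapOp_apply]
  by_cases h1 : i = l <;> by_cases h2 : j = k <;> by_cases h3 : k = j <;> simp_all

omit [Fintype m] in
/-- A diagonal gate with unimodular entries is unitary. [folklore] -/
private theorem diagonal_mem_unitaryGroup {ι : Type*} [Fintype ι] [DecidableEq ι] (d : ι → ℂ)
    (hd : ∀ p, d p * star (d p) = 1) : Matrix.diagonal d ∈ Matrix.unitaryGroup ι ℂ := by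
  rw [Matrix.mem_unitaryGroup_iff, Matrix.star_eq_conjTranspose, Matrix.diagonal_conjTranspose,
    Matrix.diagonal_mul_diagonal, ← Matrix.diagonal_one]
  congr 1
  funext p
  rw [Pi.star_apply, hd p]

/-- **SWAP times a diagonal phase gate is dual-unitary** (`F · diag(d)`, `|d| = 1`): the family
containing, up to single-site unitaries and a global phase, every two-qubit dual-unitary gate
`e^{iφ}(u₊ ⊗ u₋) V[J] (v₋ ⊗ v₊)` — in particular the self-dual kicked-Ising gates of Fischer et
al. ("for J = b = π/4 the gates are dual unitary for any choice of h"). The single-site dressing and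
the completeness of the qubit parametrisation are NOT formalised here.
[cite: BertiniKosProsen2019, eqs. (23)–(24) and SM §3 eq. (SM-22)] [cite: FischerEtAl2026, main
text ("For J = b = π/4, the gates are dual unitary for any choice of h")] -/
theorem isDualUnitary_swapOp_mul_diagonal (d : m × m → ℂ) (hd : ∀ p, d p * star (d p) = 1) :
    IsDualUnitary (swapOp m * Matrix.diagonal d) := by
  rw [isDualUnitary_iff_reshuffle]
  refine ⟨Submonoid.mul_mem _ swapOp_mem_unitaryGroup (diagonal_mem_unitaryGroup d hd), ?_⟩
  rw [reshuffle_swapOp_mul_diagonal]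
  exact Submonoid.mul_mem _ (diagonal_mem_unitaryGroup _ fun p => hd (p.2, p.1))
    swapOp_mem_unitaryGroup

/-! ### Dressing with single-site unitaries preserves dual-unitarity -/

/-- Conjugating by `u ⊗ 𝟙` conjugates the first-site marginal: `tr₂[(u⊗𝟙) Z (u⊗𝟙)†] = u (tr₂ Z) u†`.
[folklore] -/
private theorem traceRight_kronecker_one_conj (u : Matrix m m ℂ) (Z : Matrix (m × m) (m × m) ℂ) :
    traceRight ((u ⊗ₖ (1 : Matrix m m ℂ)) * Z * (u ⊗ₖ (1 : Matrix m m ℂ))ᴴ) =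
      u * traceRight Z * uᴴ := by
  rw [Matrix.conjTranspose_kronecker, Matrix.conjTranspose_one]
  ext i i'
  simp only [traceRight_apply, Matrix.mul_apply, Matrix.kroneckerMap_apply, Matrix.one_apply,
    Fintype.sum_prod_type, mul_ite, mul_one, mul_zero, ite_mul, zero_mul, Finset.sum_ite_eq,
    Finset.sum_ite_eq', Finset.mem_univ, if_true, Finset.sum_mul, Finset.mul_sum]
  exact Finset.sum_comm.trans (Finset.sum_congr rfl fun _ _ => Finset.sum_comm)

/-- Conjugating by `𝟙 ⊗ v` with `v†v = 𝟙` does not change the first-site marginal: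
`tr₂[(𝟙⊗v) Z (𝟙⊗v)†] = tr₂ Z`. [folklore] -/
private theorem traceRight_one_kronecker_conj {v : Matrix m m ℂ} (hv : vᴴ * v = 1)
    (Z : Matrix (m × m) (m × m) ℂ) :
    traceRight (((1 : Matrix m m ℂ) ⊗ₖ v) * Z * ((1 : Matrix m m ℂ) ⊗ₖ v)ᴴ) = traceRight Z := by
  have hv' : ∀ q q' : m, ∑ j, star (v j q') * v j q = if q' = q then 1 else 0 := fun q q' => by
    have := congr_fun (congr_fun hv q') q
    simpa [Matrix.mul_apply, Matrix.conjTranspose_apply, Matrix.one_apply] using this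
  rw [Matrix.conjTranspose_kronecker, Matrix.conjTranspose_one]
  ext i i'
  simp only [traceRight_apply, Matrix.mul_apply, Matrix.kroneckerMap_apply, Matrix.one_apply,
    Fintype.sum_prod_type, mul_ite, mul_zero, ite_mul, one_mul, zero_mul, Finset.sum_ite_irrel,
    Finset.sum_const_zero, Finset.sum_ite_eq, Finset.sum_ite_eq', Finset.mem_univ, if_true,
    Finset.sum_mul]
  have key : ∀ q' q : m, ∑ x, v x q * Z (i, q) (i', q') * vᴴ q' x =
      Z (i, q) (i', q') * (if q' = q then 1 else 0) := by
    intro q' q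
    rw [← hv' q q', Finset.mul_sum]
    refine Finset.sum_congr rfl fun x _ => ?_
    rw [Matrix.conjTranspose_apply]
    ring
  calc ∑ x, ∑ q', ∑ q, v x q * Z (i, q) (i', q') * vᴴ q' x
      = ∑ q', ∑ q, ∑ x, v x q * Z (i, q) (i', q') * vᴴ q' x :=
        Finset.sum_comm.trans (Finset.sum_congr rfl fun _ _ => Finset.sum_comm)
    _ = ∑ q', ∑ q, Z (i, q) (i', q') * (if q' = q then 1 else 0) :=
        Finset.sum_congr rfl fun q' _ => Finset.sum_congr rfl fun q _ => key q' q
    _ = ∑ b, Z (i, b) (i', b) := by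
        simp only [mul_ite, mul_one, mul_zero, Finset.sum_ite_eq, Finset.mem_univ, if_true]

/-- Conjugating a kronecker operator by single-site gates: `(u⊗v)(a⊗𝟙)(u⊗v)† = (u a u†) ⊗ 𝟙` when
`v v† = 𝟙`. [folklore] -/
private theorem kronecker_conj_kronecker_one (u a : Matrix m m ℂ) {v : Matrix m m ℂ}
    (hv : v * vᴴ = 1) :
    (u ⊗ₖ v) * (a ⊗ₖ (1 : Matrix m m ℂ)) * (u ⊗ₖ v)ᴴ = (u * a * uᴴ) ⊗ₖ (1 : Matrix m m ℂ) := by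
  rw [Matrix.conjTranspose_kronecker, ← Matrix.mul_kronecker_mul, ← Matrix.mul_kronecker_mul,
    Matrix.mul_one, hv]

/-- **Single-site dressing preserves dual-unitarity**: if `U` is dual-unitary and `u₊, u₋, v₋, v₊`
are single-site unitaries then `(u₊ ⊗ u₋) U (v₋ ⊗ v₊)` is dual-unitary — with
`isDualUnitary_swapOp_mul_diagonal` this covers the printed qubit family
`U = e^{iφ}(u₊ ⊗ u₋)·V[J]·(v₋ ⊗ v₊)` once `V[J]` is written as a phase gate times SWAP (that
rewriting, and the completeness of the parametrisation, are not formalised).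
[cite: BertiniKosProsen2019, eq. (23) and SM §3 eq. (SM-15) (`Õ = e^{iφ'}((v'₊)ᵀ ⊗ u'₋) Ṽ (v'₋ ⊗
(u'₊)ᵀ)`: dressing by single-site unitaries dresses the dual by single-site unitaries)] -/
theorem IsDualUnitary.conj_local {U : Matrix (m × m) (m × m) ℂ} (hU : IsDualUnitary U)
    {u₁ u₂ v₁ v₂ : Matrix m m ℂ} (hu₁ : u₁ ∈ Matrix.unitaryGroup m ℂ)
    (hu₂ : u₂ ∈ Matrix.unitaryGroup m ℂ) (hv₁ : v₁ ∈ Matrix.unitaryGroup m ℂ)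
    (hv₂ : v₂ ∈ Matrix.unitaryGroup m ℂ) :
    IsDualUnitary ((u₁ ⊗ₖ u₂) * U * (v₁ ⊗ₖ v₂)) := by
  rw [isDualUnitary_iff] at hU ⊢
  obtain ⟨hUu, hD⟩ := hU
  have huv : u₁ ⊗ₖ u₂ ∈ Matrix.unitaryGroup (m × m) ℂ := Matrix.kronecker_mem_unitary hu₁ hu₂
  have hvv : v₁ ⊗ₖ v₂ ∈ Matrix.unitaryGroup (m × m) ℂ := Matrix.kronecker_mem_unitary hv₁ hv₂
  refine ⟨Submonoid.mul_mem _ (Submonoid.mul_mem _ huv hUu) hvv, fun a => ?_⟩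
  have hv₁' : v₁ * v₁ᴴ = 1 := by
    simpa [Matrix.star_eq_conjTranspose] using Matrix.mem_unitaryGroup_iff.mp hv₁
  have hv₂' : v₂ * v₂ᴴ = 1 := by
    simpa [Matrix.star_eq_conjTranspose] using Matrix.mem_unitaryGroup_iff.mp hv₂
  have hu₂' : u₂ᴴ * u₂ = 1 := by
    simpa [Matrix.star_eq_conjTranspose] using Matrix.mem_unitaryGroup_iff'.mp hu₂
  have hu₁' : u₁ * u₁ᴴ = 1 := by
    simpa [Matrix.star_eq_conjTranspose] using Matrix.mem_unitaryGroup_iff.mp hu₁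
  have hv₁'' : v₁ᴴ * v₁ = 1 := by
    simpa [Matrix.star_eq_conjTranspose] using Matrix.mem_unitaryGroup_iff'.mp hv₁
  -- peel the dressing: (u₁⊗u₂) U (v₁⊗v₂) (a⊗1) (v₁⊗v₂)† U† (u₁⊗u₂)†
  have step1 : (u₁ ⊗ₖ u₂) * U * (v₁ ⊗ₖ v₂) * (a ⊗ₖ (1 : Matrix m m ℂ)) *
      ((u₁ ⊗ₖ u₂) * U * (v₁ ⊗ₖ v₂))ᴴ =
      (u₁ ⊗ₖ u₂) * (U * ((v₁ * a * v₁ᴴ) ⊗ₖ (1 : Matrix m m ℂ)) * Uᴴ) * (u₁ ⊗ₖ u₂)ᴴ := by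
    rw [Matrix.conjTranspose_mul, Matrix.conjTranspose_mul, ← kronecker_conj_kronecker_one v₁ a hv₂']
    simp only [Matrix.mul_assoc]
  rw [step1]
  have step2 : (u₁ ⊗ₖ u₂) = (u₁ ⊗ₖ (1 : Matrix m m ℂ)) * ((1 : Matrix m m ℂ) ⊗ₖ u₂) := by
    rw [← Matrix.mul_kronecker_mul, Matrix.mul_one, Matrix.one_mul]
  rw [step2, Matrix.conjTranspose_mul]
  have step3 : (u₁ ⊗ₖ (1 : Matrix m m ℂ)) * ((1 : Matrix m m ℂ) ⊗ₖ u₂) *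
      (U * ((v₁ * a * v₁ᴴ) ⊗ₖ (1 : Matrix m m ℂ)) * Uᴴ) *
      ((((1 : Matrix m m ℂ) ⊗ₖ u₂))ᴴ * (u₁ ⊗ₖ (1 : Matrix m m ℂ))ᴴ) =
      (u₁ ⊗ₖ (1 : Matrix m m ℂ)) * ((((1 : Matrix m m ℂ) ⊗ₖ u₂) *
        (U * ((v₁ * a * v₁ᴴ) ⊗ₖ (1 : Matrix m m ℂ)) * Uᴴ) * ((1 : Matrix m m ℂ) ⊗ₖ u₂)ᴴ)) *
      (u₁ ⊗ₖ (1 : Matrix m m ℂ))ᴴ := by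
    simp only [Matrix.mul_assoc]
  rw [step3, traceRight_kronecker_one_conj, traceRight_one_kronecker_conj hu₂', hD,
    Matrix.mul_smul, Matrix.mul_one, Matrix.smul_mul, hu₁', Matrix.trace_mul_cycle, hv₁'',
    Matrix.one_mul]

/-! ### One gate of the light cone: correlations cannot stay on the same site -/

omit [Fintype m] in
/-- `b ⊗ 𝟙` written out entrywise (the matrix of `trace_mul_traceRight`). [folklore] -/
private theorem kronecker_one_eq_of (b : Matrix m m ℂ) :
    b ⊗ₖ (1 : Matrix m m ℂ) = Matrix.of fun p q : m × m => if p.2 = q.2 then b p.1 q.1 else 0 := by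
  ext ⟨i, j⟩ ⟨k, l⟩
  simp [Matrix.kroneckerMap_apply, Matrix.one_apply]

/-- `Tr[(b ⊗ 𝟙) X] = Tr[b · tr₂ X]` (defining property of the partial trace).
[cite: BertiniKosProsen2019, eq. (8) (dynamical correlations as traces `tr[a_x 𝕌^{-t} a_y 𝕌^t]`)] -/
theorem trace_kronecker_one_mul (b : Matrix m m ℂ) (X : Matrix (m × m) (m × m) ℂ) :
    ((b ⊗ₖ (1 : Matrix m m ℂ)) * X).trace = (b * traceRight X).trace := by
  rw [trace_mul_traceRight, kronecker_one_eq_of]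

/-- **The light cone, one gate (same site).** For a dual-unitary `U` and single-site `a`, `b`:
`Tr[(b ⊗ 𝟙) · U (a ⊗ 𝟙) U†] = Tr a · Tr b`; in particular the one-gate, same-site
infinite-temperature correlator of TRACELESS local operators vanishes — "Due to the dual-unitarity
of the dynamics, correlations have a causal cone in space, together with that in time". This is the
elementary step ("using the unitarity of `Ũ`") of the proof of Property 1; the many-site, many-step
statement itself (eq. (12): zero off the light-cone edges, `tr[M_ν^{2t}(a^β) a^α]/d` on them,
eq. (17)) needs the brickwork circuit and is NOT formalised here.
[cite: BertiniKosProsen2019, Property 1, eq. (12), and its proof (case (iii), "using the unitarity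
of Ũ")] [cite: FischerEtAl2026, eq. (2) (`C_n(t) = 0` unless `n = t`) and text ("dual unitarity
limits causality to within not only a temporal but also a spatial light cone")] -/
theorem trace_sameSite_of_isDualUnitary {U : Matrix (m × m) (m × m) ℂ} (hU : IsDualUnitary U)
    (a b : Matrix m m ℂ) :
    ((b ⊗ₖ (1 : Matrix m m ℂ)) * (U * (a ⊗ₖ (1 : Matrix m m ℂ)) * Uᴴ)).trace = a.trace * b.trace := by
  rw [trace_kronecker_one_mul, ((isDualUnitary_iff U).mp hU).2 a, Matrix.mul_smul, Matrix.mul_one,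
    Matrix.trace_smul, smul_eq_mul]

/-- … hence **zero** for a traceless `a` (all `a^α`, `α ≠ 0`, of a Hilbert–Schmidt basis with
`a⁰ = 𝟙`). [cite: BertiniKosProsen2019, Property 1 / eq. (12) (one-gate step of the proof)] -/
theorem trace_sameSite_eq_zero_of_isDualUnitary {U : Matrix (m × m) (m × m) ℂ}
    (hU : IsDualUnitary U) {a : Matrix m m ℂ} (ha : a.trace = 0) (b : Matrix m m ℂ) :
    ((b ⊗ₖ (1 : Matrix m m ℂ)) * (U * (a ⊗ₖ (1 : Matrix m m ℂ)) * Uᴴ)).trace = 0 := by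
  rw [trace_sameSite_of_isDualUnitary hU, ha, zero_mul]

/-! ### The light-cone channels `M_±` (defined for every unitary gate) -/

/-- **`M₊(a) = (1/d) tr₁[U† (a ⊗ 𝟙) U]`**, the single-site channel carrying the right-moving
light-cone correlations. [cite: BertiniKosProsen2019, eq. (18)] -/
def mPlus (U : Matrix (m × m) (m × m) ℂ) (a : Matrix m m ℂ) : Matrix m m ℂ :=
  ((Fintype.card m : ℂ))⁻¹ • traceLeft (Uᴴ * (a ⊗ₖ (1 : Matrix m m ℂ)) * U)

/-- **`M₋(a) = (1/d) tr₂[U† (𝟙 ⊗ a) U]`**, the left-moving companion. [cite: BertiniKosProsen2019,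
eq. (19)] -/
def mMinus (U : Matrix (m × m) (m × m) ℂ) (a : Matrix m m ℂ) : Matrix m m ℂ :=
  ((Fintype.card m : ℂ))⁻¹ • traceRight (Uᴴ * ((1 : Matrix m m ℂ) ⊗ₖ a) * U)

/-- `M₊` is unital for unitary `U`: `M₊(𝟙) = 𝟙`. [cite: BertiniKosProsen2019, text after eq. (20)
("These maps are trace preserving, completely positive, and unital")] -/
theorem mPlus_one [Nonempty m] {U : Matrix (m × m) (m × m) ℂ} (hU : Uᴴ * U = 1) :
    mPlus U 1 = 1 := by
  unfold mPlus
  rw [Matrix.one_kronecker_one, Matrix.mul_one, hU]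
  ext b b'
  simp only [Matrix.smul_apply, traceLeft_apply, Matrix.one_apply, Prod.mk.injEq, true_and,
    smul_eq_mul]
  by_cases h : b = b'
  · subst h
    simp only [if_true, Finset.sum_const, Finset.card_univ, nsmul_eq_mul, mul_one]
    exact inv_mul_cancel₀ (Nat.cast_ne_zero.mpr Fintype.card_ne_zero)
  · simp [h]

/-- `M₊` is trace preserving for unitary `U`: `Tr M₊(a) = Tr a`. [cite: BertiniKosProsen2019,
text after eq. (20) ("trace preserving, completely positive, and unital")] -/
theorem trace_mPlus [Nonempty m] {U : Matrix (m × m) (m × m) ℂ} (hU : U * Uᴴ = 1)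
    (a : Matrix m m ℂ) : (mPlus U a).trace = a.trace := by
  unfold mPlus
  rw [Matrix.trace_smul, trace_traceLeft, Matrix.trace_mul_cycle, hU, Matrix.one_mul,
    Matrix.trace_kronecker, Matrix.trace_one, smul_eq_mul]
  have hN : (Fintype.card m : ℂ) ≠ 0 := Nat.cast_ne_zero.mpr Fintype.card_ne_zero
  field_simp

/-- `M₋` is unital for unitary `U`. [cite: BertiniKosProsen2019, text after eq. (20)] -/
theorem mMinus_one [Nonempty m] {U : Matrix (m × m) (m × m) ℂ} (hU : Uᴴ * U = 1) :
    mMinus U 1 = 1 := by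
  unfold mMinus
  rw [Matrix.one_kronecker_one, Matrix.mul_one, hU]
  ext a a'
  simp only [Matrix.smul_apply, traceRight_apply, Matrix.one_apply, Prod.mk.injEq, and_true,
    smul_eq_mul]
  by_cases h : a = a'
  · subst h
    simp only [if_true, Finset.sum_const, Finset.card_univ, nsmul_eq_mul, mul_one]
    exact inv_mul_cancel₀ (Nat.cast_ne_zero.mpr Fintype.card_ne_zero)
  · simp [h]

/-- `M₋` is trace preserving for unitary `U`. [cite: BertiniKosProsen2019, text after eq. (20)] -/
theorem trace_mMinus [Nonempty m] {U : Matrix (m × m) (m × m) ℂ} (hU : U * Uᴴ = 1)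
    (a : Matrix m m ℂ) : (mMinus U a).trace = a.trace := by
  unfold mMinus
  rw [Matrix.trace_smul, trace_traceRight, Matrix.trace_mul_cycle, hU, Matrix.one_mul,
    Matrix.trace_kronecker, Matrix.trace_one, smul_eq_mul]
  have hN : (Fintype.card m : ℂ) ≠ 0 := Nat.cast_ne_zero.mpr Fintype.card_ne_zero
  field_simp

/-! ### `M₊` for the SWAP-times-phase family: a Schur multiplier -/

omit [Fintype m] in
/-- `F (a ⊗ b) F = b ⊗ a` for the SWAP gate `F`. [folklore] -/
private theorem swapOp_mul_kronecker_mul_swapOp [Fintype m] (a b : Matrix m m ℂ) :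
    swapOp m * (a ⊗ₖ b) * swapOp m = b ⊗ₖ a := by
  ext ⟨i, j⟩ ⟨k, l⟩
  rw [swapOp_mul_mul_swapOp_apply, Matrix.kroneckerMap_apply, Matrix.kroneckerMap_apply, mul_comm]

/-- **`M₊` of `F · diag(d)` is the Schur (entrywise) multiplier** by the Gram-type matrix
`G_{jj'} = (1/d) Σ_i conj(d_{ij}) d_{ij'}`: `M₊(a)_{jj'} = G_{jj'} a_{jj'}` (so `G_{jj} = 1`:
unital; diagonal operators are fixed). For qubits and `d_{ij} = e^{−i(J−π/4) s_i s_j}` — i.e.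
`V[J] = e^{−iπ/4} F · diag(d)` — the off-diagonal factor is `cos(2J − π/2) = sin 2J`, which is the
printed `𝓜[J] = diag(1, sin 2J, sin 2J, 1)` in the Pauli basis (`schurFactor_qubit_eq_sin`,
`mPlus_swapOp_mul_diagonal_diagonal`). [cite: BertiniKosProsen2019, eq. (18) and text after eq. (26) ("`𝓜[J] ≡
diag(1, sin(2J), sin(2J), 1)`, the matrix of the map associated with the gate `V[J]`")] -/
theorem mPlus_swapOp_mul_diagonal (d : m × m → ℂ) (a : Matrix m m ℂ) :
    mPlus (swapOp m * Matrix.diagonal d) a = Matrix.of fun j j' =>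
      ((Fintype.card m : ℂ))⁻¹ * (∑ i, star (d (i, j)) * d (i, j')) * a j j' := by
  unfold mPlus
  rw [Matrix.conjTranspose_mul, Matrix.diagonal_conjTranspose, conjTranspose_swapOp,
    show Matrix.diagonal (star d) * swapOp m * (a ⊗ₖ (1 : Matrix m m ℂ)) *
        (swapOp m * Matrix.diagonal d) =
      Matrix.diagonal (star d) * (swapOp m * (a ⊗ₖ (1 : Matrix m m ℂ)) * swapOp m) *
        Matrix.diagonal d by simp only [Matrix.mul_assoc],
    swapOp_mul_kronecker_mul_swapOp]
  ext j j'
  simp only [Matrix.smul_apply, traceLeft_apply, Matrix.mul_diagonal, Matrix.diagonal_mul,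
    Matrix.kroneckerMap_apply, Matrix.one_apply, if_true, one_mul, Pi.star_apply, Matrix.of_apply,
    smul_eq_mul, Finset.mul_sum, Finset.sum_mul]
  exact Finset.sum_congr rfl fun i _ => by ring

/-- In particular `M₊` of `F · diag(d)` fixes every DIAGONAL single-site operator when `|d| = 1`
(the `1`s in `𝓜[J] = diag(1, sin 2J, sin 2J, 1)`: `𝟙 ↦ 𝟙`, `σᶻ ↦ σᶻ`).
[cite: BertiniKosProsen2019, text after eq. (26)] -/
theorem mPlus_swapOp_mul_diagonal_diagonal [Nonempty m] (d : m × m → ℂ)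
    (hd : ∀ p, d p * star (d p) = 1) (e : m → ℂ) :
    mPlus (swapOp m * Matrix.diagonal d) (Matrix.diagonal e) = Matrix.diagonal e := by
  rw [mPlus_swapOp_mul_diagonal]
  ext j j'
  rw [Matrix.of_apply]
  by_cases h : j = j'
  · subst h
    rw [Matrix.diagonal_apply_eq]
    have hs : ∑ i, star (d (i, j)) * d (i, j) = Fintype.card m := by
      rw [Finset.sum_congr rfl fun i _ => (by rw [mul_comm]; exact hd (i, j) :
        star (d (i, j)) * d (i, j) = 1), Finset.sum_const, Finset.card_univ, nsmul_eq_mul, mul_one]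
    rw [hs, inv_mul_cancel₀ (Nat.cast_ne_zero.mpr Fintype.card_ne_zero), one_mul]
  · rw [Matrix.diagonal_apply_ne _ h, mul_zero]

/-- **The qubit Schur factor of `V[J]` is `sin 2J`.** With `θ = J − π/4` and the phases
`d_{ij} = e^{−iθ s_i s_j}` of `V[J] = e^{−iπ/4} F · diag(d)` (`s_0 = 1`, `s_1 = −1`, so `d_{ij} = e^{−iθ}`
for `i = j` and `e^{+iθ}` otherwise), the off-diagonal multiplier of `mPlus_swapOp_mul_diagonal` is
`(1/2) Σ_i conj(d_{i0}) d_{i1} = cos 2θ = sin 2J` — the printed `𝓜[J] = diag(1, sin 2J, sin 2J, 1)`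
(`σˣ, σʸ ↦ sin(2J)·σˣ, σʸ`). [cite: BertiniKosProsen2019, eq. (24) and text after eq. (26)] -/
theorem schurFactor_qubit_eq_sin (J : ℝ) (d : Fin 2 × Fin 2 → ℂ)
    (hd : ∀ i j : Fin 2, d (i, j) =
      Complex.exp ((if i = j then -1 else 1) * ((J - Real.pi / 4 : ℝ) : ℂ) * Complex.I)) :
    (2 : ℂ)⁻¹ * ∑ i : Fin 2, star (d (i, 0)) * d (i, 1) = ((Real.sin (2 * J) : ℝ) : ℂ) := by
  set θ : ℝ := J - Real.pi / 4 with hθ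
  have e1 : star (d (0, 0)) * d (0, 1) = Complex.exp ((2 * θ : ℝ) * Complex.I) := by
    rw [hd, hd, if_pos rfl, if_neg (by decide), Complex.star_def, ← Complex.exp_conj,
      ← Complex.exp_add]
    congr 1
    simp only [map_mul, map_neg, map_one, Complex.conj_ofReal, Complex.conj_I, Complex.ofReal_mul,
      Complex.ofReal_ofNat]
    ring
  have e2 : star (d (1, 0)) * d (1, 1) = Complex.exp (-((2 * θ : ℝ) : ℂ) * Complex.I) := by
    rw [hd, hd, if_neg (by decide), if_pos rfl, Complex.star_def, ← Complex.exp_conj,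
      ← Complex.exp_add]
    congr 1
    simp only [map_mul, map_one, Complex.conj_ofReal, Complex.conj_I, Complex.ofReal_mul,
      Complex.ofReal_ofNat]
    ring
  rw [Fin.sum_univ_two, e1, e2, ← Complex.two_cos, ← mul_assoc, inv_mul_cancel₀ two_ne_zero, one_mul,
    ← Complex.ofReal_cos, show (2 * θ : ℝ) = 2 * J - Real.pi / 2 by rw [hθ]; ring,
    Real.cos_sub_pi_div_two]

end DualUnitary

end Literature.MathematicalPhysics.QuantumLattice
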